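import Literature.Algebra.Polynomial.CasasAlvero.Hexanomial
import HarnessLib

/-!
# The six-witness criterion (centred heptanomials)

Sequel to `Trinomial.lean`, `Char23Digits.lean` (tetranomials), `Pentanomial.lean` and `Hexanomial.lean`: a centred heptanomial
`X^d + s X^m + t X^n + u X^l + v X^j + w X^g + y X^e` (`0 < e < g < j < l < n < m < d`, `y ≠ 0`) over a field `K` with `K`-rational
roots `ρ, σ, τ, υ, φ, χ` killing the Hasse derivatives `H_m, H_n, H_l, H_j, H_g, H_e` respectively is a Casas-Alvero polynomial (every
other index `0 < i < d` is vacuous at the root `0`) and is not a `d`-th power, so `¬ CA_d(K)`; in prime characteristic the twelve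
conditions are integer congruences — the mechanism of the positive-characteristic counter-examples of [GvBLSW 2007, §3] (there
`X^{p+1} - X^p`, Prop. 7), for sparse centred polynomials with rational witnesses.

Needed from characteristic `311` on: for the digit `8` the translated–scaled normal form `X^8 + a_6 X^6 + … + a_1 X` of a Casas-Alvero
octic with `𝔽_p`-rational witnesses has at most six inner monomials, and at `p = 311` the searches with `≤ 5` inner monomials
(`cls/wsbundle/wsdigits.py` k ≤ 3, kit job j127783; `wsjob2.py` k = 4, 5 with `≤ 3` distinct witness values, kit job j128167) found
nothing, while the full support `{1, …, 6}` has the example `X^8 + 61X^6 + 31X^5 + 164X^4 + 246X^3 + 135X^2 + 295X` (witnesses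
`1, 1, 1, 149, 149, 149`; local run `logs/localws2c_k56m2.log`), re-checked by the independent brute-force checker `cls/check2.py`.
The instances live in the `Char<p>Digits` files. [cite: GrafVonBothmerEtAl2007, §3 (Prop. 7)]
-/

noncomputable section

open Polynomial

namespace Literature.Algebra.Polynomial.CasasAlvero

section Heptanomial

variable {K : Type*} [Field K] {d m n l j g e : ℕ}

/-- the tail of the centred heptanomial has degree `< d`. [cite: GrafVonBothmerEtAl2007, §3 (Prop. 7)] -/
private theorem natDegree_heptanom_tail_lt (heg : e < g) (hgj : g < j) (hjl : j < l) (hln : l < n) (hnm : n < m) (hmd : m < d)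
    (s t u v w y : K) :
    (s • (X : K[X]) ^ m + t • X ^ n + u • X ^ l + v • X ^ j + w • X ^ g + y • X ^ e).natDegree < d := by
  refine lt_of_le_of_lt (natDegree_add_le _ _) (max_lt ?_ ?_)
  · refine lt_of_le_of_lt (natDegree_add_le _ _) (max_lt ?_ ?_)
    · refine lt_of_le_of_lt (natDegree_add_le _ _) (max_lt ?_ ?_)
      · refine lt_of_le_of_lt (natDegree_add_le _ _) (max_lt ?_ ?_)
        · refine lt_of_le_of_lt (natDegree_add_le _ _) (max_lt ?_ ?_)
          · exact lt_of_le_of_lt (le_trans (natDegree_smul_le _ _) (natDegree_X_pow_le m)) hmd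
          · exact lt_of_le_of_lt (le_trans (natDegree_smul_le _ _) (natDegree_X_pow_le n)) (by omega)
        · exact lt_of_le_of_lt (le_trans (natDegree_smul_le _ _) (natDegree_X_pow_le l)) (by omega)
      · exact lt_of_le_of_lt (le_trans (natDegree_smul_le _ _) (natDegree_X_pow_le j)) (by omega)
    · exact lt_of_le_of_lt (le_trans (natDegree_smul_le _ _) (natDegree_X_pow_le g)) (by omega)
  · exact lt_of_le_of_lt (le_trans (natDegree_smul_le _ _) (natDegree_X_pow_le e)) (by omega)

/-- reassociation of the heptanomial as `X^d + tail`. [cite: GrafVonBothmerEtAl2007, §3 (Prop. 7)] -/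
private theorem heptanom_eq (s t u v w y : K) :
    (X ^ d + s • X ^ m + t • X ^ n + u • X ^ l + v • X ^ j + w • X ^ g + y • X ^ e : K[X]) =
      X ^ d + (s • X ^ m + t • X ^ n + u • X ^ l + v • X ^ j + w • X ^ g + y • X ^ e) := by
  simp only [add_assoc]

/-- its degree is `d`. [cite: GrafVonBothmerEtAl2007, §3 (Prop. 7)] -/
private theorem natDegree_heptanom (heg : e < g) (hgj : g < j) (hjl : j < l) (hln : l < n) (hnm : n < m) (hmd : m < d)
    (s t u v w y : K) :
    (X ^ d + s • X ^ m + t • X ^ n + u • X ^ l + v • X ^ j + w • X ^ g + y • X ^ e : K[X]).natDegree = d := by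
  rw [heptanom_eq, natDegree_add_eq_left_of_natDegree_lt]
  · exact natDegree_X_pow d
  · rw [natDegree_X_pow]; exact natDegree_heptanom_tail_lt heg hgj hjl hln hnm hmd s t u v w y

/-- it is monic. [cite: GrafVonBothmerEtAl2007, §3 (Prop. 7)] -/
private theorem monic_heptanom (heg : e < g) (hgj : g < j) (hjl : j < l) (hln : l < n) (hnm : n < m) (hmd : m < d)
    (s t u v w y : K) :
    (X ^ d + s • X ^ m + t • X ^ n + u • X ^ l + v • X ^ j + w • X ^ g + y • X ^ e : K[X]).Monic := by
  have h := natDegree_heptanom_tail_lt heg hgj hjl hln hnm hmd s t u v w y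
  rw [heptanom_eq]
  exact (monic_X_pow d).add_of_left
    (lt_of_le_of_lt degree_le_natDegree (by rw [degree_X_pow]; exact_mod_cast h))

/-- coefficients of the heptanomial. [cite: GrafVonBothmerEtAl2007, §3 (Prop. 7)] -/
private theorem coeff_heptanom (s t u v w y : K) (i : ℕ) :
    (X ^ d + s • X ^ m + t • X ^ n + u • X ^ l + v • X ^ j + w • X ^ g + y • X ^ e : K[X]).coeff i =
      (if i = d then 1 else 0) + (if i = m then s else 0) + (if i = n then t else 0) + (if i = l then u else 0) +
        (if i = j then v else 0) + (if i = g then w else 0) + (if i = e then y else 0) := by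
  simp only [coeff_add, coeff_smul, coeff_X_pow, smul_eq_mul, mul_ite, mul_one, mul_zero]

/-- evaluation of the heptanomial. [cite: GrafVonBothmerEtAl2007, §3 (Prop. 7)] -/
private theorem eval_heptanom (s t u v w y x : K) :
    (X ^ d + s • X ^ m + t • X ^ n + u • X ^ l + v • X ^ j + w • X ^ g + y • X ^ e : K[X]).eval x =
      x ^ d + s * x ^ m + t * x ^ n + u * x ^ l + v * x ^ j + w * x ^ g + y * x ^ e := by
  simp only [eval_add, eval_smul, eval_pow, eval_X, smul_eq_mul]

/-- evaluation of its `m`-th Hasse derivative. [cite: GrafVonBothmerEtAl2007, §3 (Prop. 7)] -/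
private theorem eval_hasseDeriv_heptanom_m (heg : e < g) (hgj : g < j) (hjl : j < l) (hln : l < n) (hnm : n < m)
    (s t u v w y x : K) :
    (hasseDeriv m (X ^ d + s • X ^ m + t • X ^ n + u • X ^ l + v • X ^ j + w • X ^ g + y • X ^ e : K[X])).eval x =
      (d.choose m : K) * x ^ (d - m) + s := by
  simp only [map_add, map_smul, hasseDeriv_X_pow, eval_add, eval_smul, eval_mul, eval_C, eval_pow, eval_X, smul_eq_mul,
    Nat.choose_self, Nat.sub_self, pow_zero, mul_one, Nat.cast_one, Nat.choose_eq_zero_of_lt hnm,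
    Nat.choose_eq_zero_of_lt (lt_trans hln hnm), Nat.choose_eq_zero_of_lt (lt_trans (lt_trans hjl hln) hnm),
    Nat.choose_eq_zero_of_lt (lt_trans (lt_trans (lt_trans hgj hjl) hln) hnm),
    Nat.choose_eq_zero_of_lt (lt_trans (lt_trans (lt_trans (lt_trans heg hgj) hjl) hln) hnm), Nat.cast_zero,
    zero_mul, mul_zero, add_zero]

/-- evaluation of its `n`-th Hasse derivative. [cite: GrafVonBothmerEtAl2007, §3 (Prop. 7)] -/
private theorem eval_hasseDeriv_heptanom_n (heg : e < g) (hgj : g < j) (hjl : j < l) (hln : l < n) (s t u v w y x : K) :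
    (hasseDeriv n (X ^ d + s • X ^ m + t • X ^ n + u • X ^ l + v • X ^ j + w • X ^ g + y • X ^ e : K[X])).eval x =
      (d.choose n : K) * x ^ (d - n) + (m.choose n : K) * s * x ^ (m - n) + t := by
  simp only [map_add, map_smul, hasseDeriv_X_pow, eval_add, eval_smul, eval_mul, eval_C, eval_pow, eval_X, smul_eq_mul,
    Nat.choose_self, Nat.sub_self, pow_zero, mul_one, Nat.cast_one, Nat.choose_eq_zero_of_lt hln,
    Nat.choose_eq_zero_of_lt (lt_trans hjl hln), Nat.choose_eq_zero_of_lt (lt_trans (lt_trans hgj hjl) hln),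
    Nat.choose_eq_zero_of_lt (lt_trans (lt_trans (lt_trans heg hgj) hjl) hln), Nat.cast_zero,
    zero_mul, mul_zero, add_zero]
  ring

/-- evaluation of its `l`-th Hasse derivative. [cite: GrafVonBothmerEtAl2007, §3 (Prop. 7)] -/
private theorem eval_hasseDeriv_heptanom_l (heg : e < g) (hgj : g < j) (hjl : j < l) (s t u v w y x : K) :
    (hasseDeriv l (X ^ d + s • X ^ m + t • X ^ n + u • X ^ l + v • X ^ j + w • X ^ g + y • X ^ e : K[X])).eval x =
      (d.choose l : K) * x ^ (d - l) + (m.choose l : K) * s * x ^ (m - l) + (n.choose l : K) * t * x ^ (n - l) + u := by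
  simp only [map_add, map_smul, hasseDeriv_X_pow, eval_add, eval_smul, eval_mul, eval_C, eval_pow, eval_X, smul_eq_mul,
    Nat.choose_self, Nat.sub_self, pow_zero, mul_one, Nat.cast_one, Nat.choose_eq_zero_of_lt hjl,
    Nat.choose_eq_zero_of_lt (lt_trans hgj hjl), Nat.choose_eq_zero_of_lt (lt_trans (lt_trans heg hgj) hjl), Nat.cast_zero,
    zero_mul, mul_zero, add_zero]
  ring

/-- evaluation of its `j`-th Hasse derivative. [cite: GrafVonBothmerEtAl2007, §3 (Prop. 7)] -/
private theorem eval_hasseDeriv_heptanom_j (heg : e < g) (hgj : g < j) (s t u v w y x : K) :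
    (hasseDeriv j (X ^ d + s • X ^ m + t • X ^ n + u • X ^ l + v • X ^ j + w • X ^ g + y • X ^ e : K[X])).eval x =
      (d.choose j : K) * x ^ (d - j) + (m.choose j : K) * s * x ^ (m - j) + (n.choose j : K) * t * x ^ (n - j) +
        (l.choose j : K) * u * x ^ (l - j) + v := by
  simp only [map_add, map_smul, hasseDeriv_X_pow, eval_add, eval_smul, eval_mul, eval_C, eval_pow, eval_X, smul_eq_mul,
    Nat.choose_self, Nat.sub_self, pow_zero, mul_one, Nat.cast_one, Nat.choose_eq_zero_of_lt hgj,
    Nat.choose_eq_zero_of_lt (lt_trans heg hgj), Nat.cast_zero, zero_mul, mul_zero, add_zero]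
  ring

/-- evaluation of its `g`-th Hasse derivative. [cite: GrafVonBothmerEtAl2007, §3 (Prop. 7)] -/
private theorem eval_hasseDeriv_heptanom_g (heg : e < g) (s t u v w y x : K) :
    (hasseDeriv g (X ^ d + s • X ^ m + t • X ^ n + u • X ^ l + v • X ^ j + w • X ^ g + y • X ^ e : K[X])).eval x =
      (d.choose g : K) * x ^ (d - g) + (m.choose g : K) * s * x ^ (m - g) + (n.choose g : K) * t * x ^ (n - g) +
        (l.choose g : K) * u * x ^ (l - g) + (j.choose g : K) * v * x ^ (j - g) + w := by
  simp only [map_add, map_smul, hasseDeriv_X_pow, eval_add, eval_smul, eval_mul, eval_C, eval_pow, eval_X, smul_eq_mul,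
    Nat.choose_self, Nat.sub_self, pow_zero, mul_one, Nat.cast_one, Nat.choose_eq_zero_of_lt heg, Nat.cast_zero, zero_mul,
    mul_zero, add_zero]
  ring

/-- evaluation of its `e`-th Hasse derivative. [cite: GrafVonBothmerEtAl2007, §3 (Prop. 7)] -/
private theorem eval_hasseDeriv_heptanom_e (s t u v w y x : K) :
    (hasseDeriv e (X ^ d + s • X ^ m + t • X ^ n + u • X ^ l + v • X ^ j + w • X ^ g + y • X ^ e : K[X])).eval x =
      (d.choose e : K) * x ^ (d - e) + (m.choose e : K) * s * x ^ (m - e) + (n.choose e : K) * t * x ^ (n - e) +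
        (l.choose e : K) * u * x ^ (l - e) + (j.choose e : K) * v * x ^ (j - e) + (g.choose e : K) * w * x ^ (g - e) + y := by
  simp only [map_add, map_smul, hasseDeriv_X_pow, eval_add, eval_smul, eval_mul, eval_C, eval_pow, eval_X, smul_eq_mul,
    Nat.choose_self, Nat.sub_self, pow_zero, mul_one, Nat.cast_one]
  ring

set_option maxHeartbeats 1600000 in
/-- **six-witness criterion**: a centred heptanomial with roots killing `H_m`, `H_n`, `H_l`, `H_j`, `H_g`, `H_e` is Casas-Alvero —
the mechanism of the positive-characteristic counter-examples of [GvBLSW 2007, §3] (there `X^{p+1} - X^p`, Prop. 7), for sparse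
centred polynomials with rational witnesses. [cite: GrafVonBothmerEtAl2007, §3 (Prop. 7)] -/
theorem isCasasAlvero_heptanom (he0 : 0 < e) (heg : e < g) (hgj : g < j) (hjl : j < l) (hln : l < n) (hnm : n < m)
    (hmd : m < d) {s t u v w y ρ σ τ υ φ χ : K}
    (hρf : (X ^ d + s • X ^ m + t • X ^ n + u • X ^ l + v • X ^ j + w • X ^ g + y • X ^ e : K[X]).eval ρ = 0)
    (hρH : (hasseDeriv m (X ^ d + s • X ^ m + t • X ^ n + u • X ^ l + v • X ^ j + w • X ^ g + y • X ^ e : K[X])).eval ρ = 0)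
    (hσf : (X ^ d + s • X ^ m + t • X ^ n + u • X ^ l + v • X ^ j + w • X ^ g + y • X ^ e : K[X]).eval σ = 0)
    (hσH : (hasseDeriv n (X ^ d + s • X ^ m + t • X ^ n + u • X ^ l + v • X ^ j + w • X ^ g + y • X ^ e : K[X])).eval σ = 0)
    (hτf : (X ^ d + s • X ^ m + t • X ^ n + u • X ^ l + v • X ^ j + w • X ^ g + y • X ^ e : K[X]).eval τ = 0)
    (hτH : (hasseDeriv l (X ^ d + s • X ^ m + t • X ^ n + u • X ^ l + v • X ^ j + w • X ^ g + y • X ^ e : K[X])).eval τ = 0)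
    (hυf : (X ^ d + s • X ^ m + t • X ^ n + u • X ^ l + v • X ^ j + w • X ^ g + y • X ^ e : K[X]).eval υ = 0)
    (hυH : (hasseDeriv j (X ^ d + s • X ^ m + t • X ^ n + u • X ^ l + v • X ^ j + w • X ^ g + y • X ^ e : K[X])).eval υ = 0)
    (hφf : (X ^ d + s • X ^ m + t • X ^ n + u • X ^ l + v • X ^ j + w • X ^ g + y • X ^ e : K[X]).eval φ = 0)
    (hφH : (hasseDeriv g (X ^ d + s • X ^ m + t • X ^ n + u • X ^ l + v • X ^ j + w • X ^ g + y • X ^ e : K[X])).eval φ = 0)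
    (hχf : (X ^ d + s • X ^ m + t • X ^ n + u • X ^ l + v • X ^ j + w • X ^ g + y • X ^ e : K[X]).eval χ = 0)
    (hχH : (hasseDeriv e (X ^ d + s • X ^ m + t • X ^ n + u • X ^ l + v • X ^ j + w • X ^ g + y • X ^ e : K[X])).eval χ = 0) :
    IsCasasAlvero (X ^ d + s • X ^ m + t • X ^ n + u • X ^ l + v • X ^ j + w • X ^ g + y • X ^ e : K[X]) := by
  intro i hi0 hi
  rw [natDegree_heptanom heg hgj hjl hln hnm hmd] at hi
  by_cases him : i = m
  · subst him; exact ⟨ρ, hρf, hρH⟩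
  by_cases hin : i = n
  · subst hin; exact ⟨σ, hσf, hσH⟩
  by_cases hil : i = l
  · subst hil; exact ⟨τ, hτf, hτH⟩
  by_cases hij : i = j
  · subst hij; exact ⟨υ, hυf, hυH⟩
  by_cases hig : i = g
  · subst hig; exact ⟨φ, hφf, hφH⟩
  by_cases hie : i = e
  · subst hie; exact ⟨χ, hχf, hχH⟩
  apply sharesRoot_of_coeff_eq_zero
  · rw [eval_heptanom, zero_pow (by omega), zero_pow (by omega), zero_pow (by omega), zero_pow (by omega),
      zero_pow (by omega), zero_pow (by omega), zero_pow (by omega)]; ring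
  · rw [coeff_heptanom, if_neg (by omega), if_neg him, if_neg hin, if_neg hil, if_neg hij, if_neg hig, if_neg hie]; ring

/-- a centred heptanomial with `y ≠ 0` is not a pure `d`-th power. [cite: GrafVonBothmerEtAl2007, §3 (Prop. 7)] -/
theorem heptanom_ne_pow (he0 : 0 < e) (heg : e < g) (hgj : g < j) (hjl : j < l) (hln : l < n) (hnm : n < m) (hmd : m < d)
    {s t u v w y : K} (hy : y ≠ 0) (a : K) :
    (X ^ d + s • X ^ m + t • X ^ n + u • X ^ l + v • X ^ j + w • X ^ g + y • X ^ e : K[X]) ≠ (X - C a) ^ d := by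
  intro h
  have h0 := congrArg (eval 0) h
  rw [eval_heptanom, zero_pow (by omega), zero_pow (by omega), zero_pow (by omega), zero_pow (by omega),
    zero_pow (by omega), zero_pow (by omega), zero_pow (by omega)] at h0
  simp only [mul_zero, add_zero, eval_pow, eval_sub, eval_X, eval_C, zero_sub] at h0
  have ha : a = 0 := neg_eq_zero.mp ((pow_eq_zero_iff (by omega : d ≠ 0)).mp h0.symm)
  subst ha
  have hc := congrArg (fun q : K[X] => q.coeff e) h
  simp only [coeff_heptanom, map_zero, sub_zero, coeff_X_pow, if_neg (by omega : ¬ e = d),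
    if_neg (by omega : ¬ e = m), if_neg (by omega : ¬ e = n), if_neg (by omega : ¬ e = l), if_neg (by omega : ¬ e = j),
    if_neg (ne_of_lt heg), zero_add] at hc
  exact hy hc

/-- **heptanomial refutation of `CA_d`**: twelve identities in `K` and `y ≠ 0` give a Casas-Alvero polynomial of degree `d`
that is not a `d`-th power (a counter-example in the sense of [GvBLSW 2007, §3]). [cite: GrafVonBothmerEtAl2007, §3 (Prop. 7)] -/
theorem not_holdsInDegree_of_heptanomial (he0 : 0 < e) (heg : e < g) (hgj : g < j) (hjl : j < l) (hln : l < n) (hnm : n < m)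
    (hmd : m < d) {s t u v w y : K} (hy : y ≠ 0) (ρ σ τ υ φ χ : K)
    (h1 : ρ ^ d + s * ρ ^ m + t * ρ ^ n + u * ρ ^ l + v * ρ ^ j + w * ρ ^ g + y * ρ ^ e = 0)
    (h2 : (d.choose m : K) * ρ ^ (d - m) + s = 0)
    (h3 : σ ^ d + s * σ ^ m + t * σ ^ n + u * σ ^ l + v * σ ^ j + w * σ ^ g + y * σ ^ e = 0)
    (h4 : (d.choose n : K) * σ ^ (d - n) + (m.choose n : K) * s * σ ^ (m - n) + t = 0)
    (h5 : τ ^ d + s * τ ^ m + t * τ ^ n + u * τ ^ l + v * τ ^ j + w * τ ^ g + y * τ ^ e = 0)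
    (h6 : (d.choose l : K) * τ ^ (d - l) + (m.choose l : K) * s * τ ^ (m - l) + (n.choose l : K) * t * τ ^ (n - l) + u = 0)
    (h7 : υ ^ d + s * υ ^ m + t * υ ^ n + u * υ ^ l + v * υ ^ j + w * υ ^ g + y * υ ^ e = 0)
    (h8 : (d.choose j : K) * υ ^ (d - j) + (m.choose j : K) * s * υ ^ (m - j) + (n.choose j : K) * t * υ ^ (n - j) +
      (l.choose j : K) * u * υ ^ (l - j) + v = 0)
    (h9 : φ ^ d + s * φ ^ m + t * φ ^ n + u * φ ^ l + v * φ ^ j + w * φ ^ g + y * φ ^ e = 0)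
    (h10 : (d.choose g : K) * φ ^ (d - g) + (m.choose g : K) * s * φ ^ (m - g) + (n.choose g : K) * t * φ ^ (n - g) +
      (l.choose g : K) * u * φ ^ (l - g) + (j.choose g : K) * v * φ ^ (j - g) + w = 0)
    (h11 : χ ^ d + s * χ ^ m + t * χ ^ n + u * χ ^ l + v * χ ^ j + w * χ ^ g + y * χ ^ e = 0)
    (h12 : (d.choose e : K) * χ ^ (d - e) + (m.choose e : K) * s * χ ^ (m - e) + (n.choose e : K) * t * χ ^ (n - e) +
      (l.choose e : K) * u * χ ^ (l - e) + (j.choose e : K) * v * χ ^ (j - e) + (g.choose e : K) * w * χ ^ (g - e) + y = 0) :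
    ¬ HoldsInDegree K d := by
  intro h
  have hCA : IsCasasAlvero (X ^ d + s • X ^ m + t • X ^ n + u • X ^ l + v • X ^ j + w • X ^ g + y • X ^ e : K[X]) :=
    isCasasAlvero_heptanom he0 heg hgj hjl hln hnm hmd (by rw [eval_heptanom]; exact h1)
      (by rw [eval_hasseDeriv_heptanom_m heg hgj hjl hln hnm]; exact h2) (by rw [eval_heptanom]; exact h3)
      (by rw [eval_hasseDeriv_heptanom_n heg hgj hjl hln]; exact h4) (by rw [eval_heptanom]; exact h5)
      (by rw [eval_hasseDeriv_heptanom_l heg hgj hjl]; exact h6) (by rw [eval_heptanom]; exact h7)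
      (by rw [eval_hasseDeriv_heptanom_j heg hgj]; exact h8) (by rw [eval_heptanom]; exact h9)
      (by rw [eval_hasseDeriv_heptanom_g heg]; exact h10) (by rw [eval_heptanom]; exact h11)
      (by rw [eval_hasseDeriv_heptanom_e]; exact h12)
  obtain ⟨a, ha⟩ := h _ (monic_heptanom heg hgj hjl hln hnm hmd s t u v w y)
    (natDegree_heptanom heg hgj hjl hln hnm hmd s t u v w y) hCA
  exact heptanom_ne_pow he0 heg hgj hjl hln hnm hmd hy a ha

end Heptanomial

end Literature.Algebra.Polynomial.CasasAlvero
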